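/-
Copyright: the b2b-balaban T⁴-continuum CRUX team, row NE7b OWNER lineage `t4-ne7b-p1` (gen 124). Project licence.
-/
import Summits.QuantumFields.BalabanUV.T4Continuum.Spine.NE7b.SupZdKernelNeumann
import Summits.QuantumFields.BalabanUV.T4Continuum.Spine.NE7b.SupZdPerturbedCoarseEntries
import Summits.QuantumFields.BalabanUV.T4Continuum.Spine.NE7b.SupZdCoarseInverseIdentities

/-!
# THE PERTURBED NEXT-SCALE HESSIAN ON `ℤ^d`: for `V : ℤ^d → [−λ, Λ]` (`d ≥ 3`, every mesh) and a kernel `|K(p,q)| ≤ εe^{−γ|p − q|₁}` under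
# three explicit smallness conditions on `ε` (constants from `(d, a, λ, Λ)` ONLY), the perturbed coarse operator
# `T_K(b,c) = (n+1)^{−d}Σ_{q∈B n b}Ψ^K_c(q)` of the `H + K` column has a TWO-SIDED inverse `N_K` on the block lattice `ℤ^d` with
# `|N_K(b,c)| ≤ 2c₁e^{νd}K_{δ₁−ν}e^{−ν|b−c|₁}` and `T_KN_K = 1 = N_KT_K` (rows absolutely convergent) — (217)'s Neumann engine on
# `T_K = T + E_K` around (194)'s `M = T⁻¹`, once directly (right inverse) and once on the transposed data (left inverse), glued by (217)'s
# `L = N`; NO floor, NO `ℓ²`, NO torus (row NE7b, node U5c; (186)∕(194)∕(195)∕(216)∕(217) BY NAME; [folklore])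

Cell `pub-balaban`, sub-cell `t4`, spine estimate NE7b (`T4WeightBudget.RelWeightBound`; the cell's OWN estimate — NOT PRINTED in
[Bałaban 1983–89], NOT PROVED).  Crux-route work under `Spine/NE7b/` by the row OWNER (`t4-ne7b-p1` gen 124, file (218)) under FREEZE
(0)'s crux-prover clause; NOTHING of Bałaban's is named as a Lean object, valued or asserted; no `T4Continuum/Support` leaf typed; no `def`,
no notation (`T`, `T_K`, `E_K = T_K − T`, `θ`, `C_PK_{δ₀−μ}` WRITTEN OUT; `M` and the block columns are DATA with their defining
properties as hypotheses, exactly as in (195)); zero `sorry`.  Imports (BY NAME): the OWNER's (217) `…SupZdKernelNeumann`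
(`decaying_right_inverse`, `left_inverse_eq_right_inverse`), (216) `…SupZdPerturbedCoarseEntries` (`zd_perturbed_coarse_entries`), (195)
`…SupZdCoarseInverseIdentities` (`zd_coarse_mul_inverse`, `zd_coarse_inverse_mul`; through it (194) `zd_coarse_section_inverse`, (186)
`zd_coarse_entry_decay`, (191) `natAbs_sub_comm_sum`), Mathlib's `le_of_tendsto'`.

WHY (located).  § [NE7bP1-G124-HANDOFF] NEXT (3)(a): "invert the infinite-volume coarse operator on `ℤ^d`" — done for `T = T_0` in
(194)∕(195) by sections and a floor; this file does it for the PERTURBED operator `T_K` of the `H + K` column, where no floor is available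
on the sup road.  The route is perturbative and entirely on `ℤ^d`: (216) (iii) `T_K = T + E_K`, `|E_K(b,c)| ≤ 4C_PK_{δ₀−μ}θe^{−μ|b−c|₁}`
(`θ ∝ ε`); (186) `|T(b,c)| ≤ C_Te^{−δ_T|b−c|₁}`; (194) `|M(b,c)| ≤ c₁e^{−δ₁|b−c|₁}` for every cube limit `M` (limits of uniformly decaying
section entries); (195) `TM = 1 = MT`; so (217)'s `decaying_right_inverse` applies at any rate `ν < min(δ₁, μ)` once
`(c₁e^{νd}K_{δ₁−ν})(4C_PK_{δ₀−μ}θe^{νd}K_{μ−ν}) ≤ 1∕2` and yields `N` with `(T + E_K)N = 1`; the `ℓ¹`-distance is symmetric, so the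
transposed kernels satisfy the same bounds with `MT = 1` in place of `TM = 1`, and the engine yields `N′` with `(T + E_K)ᵗN′ = 1`, i.e.
`L := N′ᵗ` is a decaying LEFT inverse; `T_K` is bounded ((216) (ii)), so (217)'s Fubini lemma gives `L = N`.

WHAT IS PROVED ([folklore]): §1 **`zd_perturbed_coarse_inverse`** (THE END: `∃ C₀ C_P δ₀ c₁ δ₁ > 0`: for ALL `n, V`, unperturbed block
columns `Ψ`, cube limits `M`, `ε, γ, μ, ν` with the three smallness conditions, kernels `K` of the class and perturbed block columns `Ψ^K`:
`∃ N` with the profile bound, `Σ′T_K(b,b′)N(b′,c) = δ_{bc}` and `Σ′N(b,b′)T_K(b′,c) = δ_{bc}`, rows summable); §2 toy.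

HONEST (what this is NOT).  The INVERSE KERNEL only: `N_K` is not claimed symmetric (no symmetry of `K` assumed), no `ℓ²`∕operator-norm
or floor statement, no Lipschitz-in-`K` bound for `N_K` (it follows from `N_K − M = −ME_KN_K` and is the sequel), no torus → `ℤ^d` limit for
the `H + K` tower; THREE smallness conditions with the sup road's constants — NOT (163)'s energy threshold; the LINEAR column only; `d ≥ 3`
only; scalar skeleton ((A3), NC-NE7b-α UNRULED); nothing of the covariant propagators of [B4]–[B6]; nothing of Bałaban's asserted.
BY-NAME EFFECT ON THE WALL: NONE.  NE7b NOT PRINTED ∕ NOT PROVED; spine PROVED 0∕9; rung (B)+1 — the programme's measures remain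
FINITE-torus statements; NOT the mass gap, NOT Clay.  HONEST DEPENDENCY: continuum YM on T⁴ ⇐ BetaPertH ∧ nine spine estimates (0∕9
proved); BetaPertH ⇐ (D1) ∧ (D4) ∧ CAP+tail; G-an2-4 gates asym, D1 and NE2∕3∕4.
-/

set_option autoImplicit false

noncomputable section

namespace Summit.QuantumFields.BalabanUV.T4Continuum.NE7b.SupZdPerturbedCoarseInverse

open Real Filter Topology
open scoped ENNReal
open Literature.MathematicalPhysics.QuantumFieldTheory.Balaban1983to89
open B6QGQLower276 (X e blk B)
open SupZdCoarseOperator (zd_coarse_entry_decay)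
open SupZdCoarseForm (natAbs_sub_comm_sum)
open SupZdCoarseInverse (zd_coarse_section_inverse)
open SupZdCoarseInverseIdentities (zd_coarse_mul_inverse zd_coarse_inverse_mul)
open SupZdPerturbedCoarseEntries (zd_perturbed_coarse_entries)
open SupZdKernelNeumann (decaying_right_inverse left_inverse_eq_right_inverse)

variable {d : ℕ}

/-! ## §1. THE END: the perturbed coarse operator `T_K` is inverted on `ℤ^d`, two-sidedly, in the decaying class -/

/-- **HEADLINE — THE PERTURBED NEXT-SCALE HESSIAN EXISTS ON `ℤ^d`**: `d ≥ 3`, `a > 0`, `λ < min(2,a)`, `Λ ≥ 0` ⟹ `∃ C₀ C_P δ₀ c₁ δ₁ > 0`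
(from `(d, a, λ, Λ)` ONLY: (216)'s three constants and (194)'s section constants) such that for ALL `n`, `V : ℤ^d → [−λ, Λ]`, every family
`Ψ` of bounded unperturbed block columns (`H_VΨ_c = 𝟙_{B n c}`), every cube limit `M` of the section inverses of `T(b,c) =
(n+1)^{−d}Σ_{q∈B n b}Ψ_c(q)` ((194)), all `ε ≥ 0`, `0 < ν < μ < min(δ₀, γ)`, `ν < δ₁`, under THREE smallness conditions on `ε` — (213)'s
`εK_γC₀ ≤ 1∕2`, (215)'s `θ := C_PK_{δ₀−μ}·εe^{μd}K_{γ−μ} ≤ 1∕2`, and the Neumann condition `(c₁e^{νd}K_{δ₁−ν})·(4C_PK_{δ₀−μ}θ·e^{νd}K_{μ−ν})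
≤ 1∕2` — every kernel `|K(p,q)| ≤ εe^{−γ|p−q|₁}` and every family `Ψ^K` of bounded PERTURBED block columns (`(H_V + K)Ψ^K_c = 𝟙_{B n c}`;
they exist and are unique by (216)): the perturbed coarse operator `T_K(b,c) = (n+1)^{−d}Σ_{q∈B n b}Ψ^K_c(q)` has a TWO-SIDED inverse `N_K`
on `ℤ^d` with `|N_K(b,c)| ≤ 2c₁e^{νd}K_{δ₁−ν}·e^{−ν|b−c|₁}`: `Σ′_{b′}T_K(b,b′)N_K(b′,c) = δ_{bc} = Σ′_{b′}N_K(b,b′)T_K(b′,c)` (rows absolutely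
convergent) — (217)'s Neumann engine on `T_K = T + E_K` around `M` ((186) `T` decays, (194)∕(195) `M` decays and `TM = MT = 1`, (216)
`|E_K| ≤ 4C_PK_{δ₀−μ}θe^{−μ|b−c|₁}`) for the right inverse, the same on the TRANSPOSED data for a left inverse, and (217)'s `L = N`.
The perturbed next-scale Hessian on `ℤ^d` is `(n+1)^d·N_K`. [folklore] -/
theorem zd_perturbed_coarse_inverse (hd : 3 ≤ d) (a : ℝ) (ha : 0 < a) {lam Lam : ℝ} (hlam : lam < min 2 a) (hLam : 0 ≤ Lam) :
    ∃ C₀ CP δ₀ c₁ δ₁ : ℝ, 0 < C₀ ∧ 0 < CP ∧ 0 < δ₀ ∧ 0 < c₁ ∧ 0 < δ₁ ∧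
    ∀ (n : ℕ) (V : X d → ℝ), (∀ p, -lam ≤ V p) → (∀ p, V p ≤ Lam) →
    ∀ (Ψ : X d → X d → ℝ) (BΨ : X d → ℝ), (∀ c p, |Ψ c p| ≤ BΨ c) →
      (∀ c p, ((n : ℝ) + 1) ^ 2 * ∑ μ', (2 * Ψ c p - Ψ c (p + e μ') - Ψ c (p - e μ'))
        + a / ((n : ℝ) + 1) ^ d * ∑ q ∈ B n (blk n p), Ψ c q + V p * Ψ c p = if blk n p = c then 1 else 0) →
    ∀ (M : X d → X d → ℝ), (∀ b b' : X d, Tendsto (fun R : ℕ =>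
      if h : b ∈ (Fintype.piFinset fun _ : Fin d => Finset.Icc (-(R : ℤ)) R) ∧
          b' ∈ (Fintype.piFinset fun _ : Fin d => Finset.Icc (-(R : ℤ)) R)
        then (Matrix.of fun c c' : ↥(Fintype.piFinset fun _ : Fin d => Finset.Icc (-(R : ℤ)) R) =>
          (((n : ℝ) + 1) ^ d)⁻¹ * ∑ q ∈ B n (c : X d), Ψ (c' : X d) q)⁻¹ ⟨b, h.1⟩ ⟨b', h.2⟩ else 0)
      atTop (𝓝 (M b b'))) →
    ∀ (ε γ μ ν : ℝ), 0 ≤ ε → 0 < μ → μ < δ₀ → μ < γ → 0 < ν → ν < μ → ν < δ₁ →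
      ε * (2 * (1 - exp (-γ))⁻¹) ^ d * C₀ ≤ 1 / 2 →
      (CP * (2 * (1 - exp (-(δ₀ - μ)))⁻¹) ^ d) * (ε * exp (μ * d) * (2 * (1 - exp (-(γ - μ)))⁻¹) ^ d) ≤ 1 / 2 →
      (c₁ * exp (ν * d) * (2 * (1 - exp (-(δ₁ - ν)))⁻¹) ^ d)
        * ((4 * (CP * (2 * (1 - exp (-(δ₀ - μ)))⁻¹) ^ d)
            * ((CP * (2 * (1 - exp (-(δ₀ - μ)))⁻¹) ^ d) * (ε * exp (μ * d) * (2 * (1 - exp (-(γ - μ)))⁻¹) ^ d)))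
          * exp (ν * d) * (2 * (1 - exp (-(μ - ν)))⁻¹) ^ d) ≤ 1 / 2 →
    ∀ (K : X d → X d → ℝ), (∀ p q, |K p q| ≤ ε * exp (-(γ * ∑ i, (((p i - q i).natAbs : ℕ) : ℝ)))) →
    ∀ (ΨK : X d → X d → ℝ) (BΨK : X d → ℝ), (∀ c p, |ΨK c p| ≤ BΨK c) →
      (∀ c p, ((n : ℝ) + 1) ^ 2 * ∑ μ', (2 * ΨK c p - ΨK c (p + e μ') - ΨK c (p - e μ'))
        + a / ((n : ℝ) + 1) ^ d * ∑ q ∈ B n (blk n p), ΨK c q + V p * ΨK c p + ∑' q : X d, K p q * ΨK c q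
          = if blk n p = c then 1 else 0) →
    ∃ N : X d → X d → ℝ,
      (∀ b c, |N b c| ≤ 2 * (c₁ * exp (ν * d) * (2 * (1 - exp (-(δ₁ - ν)))⁻¹) ^ d) * exp (-(ν * ∑ i, (((b i - c i).natAbs : ℕ) : ℝ)))) ∧
      (∀ b c, Summable (fun b' : X d => ((((n : ℝ) + 1) ^ d)⁻¹ * ∑ q ∈ B n b, ΨK b' q) * N b' c) ∧
        ∑' b' : X d, ((((n : ℝ) + 1) ^ d)⁻¹ * ∑ q ∈ B n b, ΨK b' q) * N b' c = if b = c then 1 else 0) ∧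
      (∀ b c, Summable (fun b' : X d => N b b' * ((((n : ℝ) + 1) ^ d)⁻¹ * ∑ q ∈ B n b', ΨK c q)) ∧
        ∑' b' : X d, N b b' * ((((n : ℝ) + 1) ^ d)⁻¹ * ∑ q ∈ B n b', ΨK c q) = if b = c then 1 else 0) := by
  classical
  obtain ⟨C₀, CP, δ₀, hC₀, hCP, hδ₀, H216⟩ := zd_perturbed_coarse_entries (d := d) hd a ha hlam hLam
  obtain ⟨CT, δT, hCT, hδT, H186⟩ := zd_coarse_entry_decay (d := d) hd a ha hlam hLam
  obtain ⟨c₁, δ₁, hc₁, hδ₁, H194⟩ := zd_coarse_section_inverse (d := d) hd a ha hlam hLam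
  refine ⟨C₀, CP, δ₀, c₁, δ₁, hC₀, hCP, hδ₀, hc₁, hδ₁, ?_⟩
  intro n V hV hV' Ψ BΨ hΨB hΨ M hM ε γ μ ν hε hμ hμδ hμγ hν hνμ hνδ hsmall1 hsmall2 hsmall3 K hK ΨK BΨK hΨKB hΨK
  obtain ⟨-, H2, H3⟩ := H216 n V hV hV' ε γ μ hε hμ hμδ hμγ hsmall1 hsmall2 K hK
  have hKδμ : 0 < (2 * (1 - exp (-(δ₀ - μ)))⁻¹) ^ d := pow_pos (mul_pos two_pos (inv_pos.2 (sub_pos.2 (exp_lt_one_iff.2 (by linarith))))) d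
  have hKγμ : 0 < (2 * (1 - exp (-(γ - μ)))⁻¹) ^ d := pow_pos (mul_pos two_pos (inv_pos.2 (sub_pos.2 (exp_lt_one_iff.2 (by linarith))))) d
  obtain ⟨CPK, hCPK⟩ : ∃ CPK : ℝ, CPK = CP * (2 * (1 - exp (-(δ₀ - μ)))⁻¹) ^ d := ⟨_, rfl⟩
  have hCPK0 : 0 < CPK := by rw [hCPK]; exact mul_pos hCP hKδμ
  obtain ⟨θ, hθ⟩ : ∃ θ : ℝ, θ = CPK * (ε * exp (μ * d) * (2 * (1 - exp (-(γ - μ)))⁻¹) ^ d) := ⟨_, rfl⟩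
  have hθ0 : 0 ≤ θ := by rw [hθ]; exact mul_nonneg hCPK0.le (mul_nonneg (mul_nonneg hε (exp_pos _).le) hKγμ.le)
  have hη : 0 ≤ 4 * CPK * θ := by positivity
  have hsmall3' : (c₁ * exp (ν * d) * (2 * (1 - exp (-(δ₁ - ν)))⁻¹) ^ d)
      * ((4 * CPK * θ) * exp (ν * d) * (2 * (1 - exp (-(μ - ν)))⁻¹) ^ d) ≤ 1 / 2 := by rw [hθ, hCPK]; exact hsmall3
  -- the three kernels
  obtain ⟨T, hT⟩ : ∃ T : X d → X d → ℝ, ∀ b c, T b c = (((n : ℝ) + 1) ^ d)⁻¹ * ∑ q ∈ B n b, Ψ c q := ⟨_, fun _ _ => rfl⟩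
  obtain ⟨TK, hTK⟩ : ∃ TK : X d → X d → ℝ, ∀ b c, TK b c = (((n : ℝ) + 1) ^ d)⁻¹ * ∑ q ∈ B n b, ΨK c q := ⟨_, fun _ _ => rfl⟩
  obtain ⟨E, hE⟩ : ∃ E : X d → X d → ℝ, ∀ b c, E b c = TK b c - T b c := ⟨_, fun _ _ => rfl⟩
  have hTE : ∀ b c, T b c + E b c = TK b c := fun b c => by rw [hE]; ring
  -- decay of `T` ((186)), `E` ((216) (iii)), `M` ((194)); `TM = 1 = MT` ((195)); `T_K` bounded ((216) (ii))
  have hTd : ∀ b c, |T b c| ≤ CT * exp (-(δT * ∑ i, (((b i - c i).natAbs : ℕ) : ℝ))) := fun b c => by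
    rw [hT]; exact H186 n V hV hV' Ψ BΨ hΨB hΨ b c
  have hEd : ∀ b c, |E b c| ≤ 4 * CPK * θ * exp (-(μ * ∑ i, (((b i - c i).natAbs : ℕ) : ℝ))) := by
    intro b c
    have h := (H3 c (ΨK c) (BΨK c) (hΨKB c) (hΨK c) (Ψ c) (BΨ c) (hΨB c) (hΨ c)).2 b
    rw [hE, hTK, hT, hθ, hCPK]
    exact h
  have hTKb : ∀ b c, |TK b c| ≤ 2 * CPK := fun b c => by
    rw [hTK, hCPK]
    exact ((H2 c (ΨK c) (BΨK c) (hΨKB c) (hΨK c)).2 b).trans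
      (mul_le_of_le_one_right (by positivity) (exp_le_one_iff.2 (neg_nonpos.2 (by positivity))))
  have hMd : ∀ b c, |M b c| ≤ c₁ * exp (-(δ₁ * ∑ i, (((b i - c i).natAbs : ℕ) : ℝ))) := fun b c =>
    le_of_tendsto' (hM b c).abs fun R => by
      split_ifs with h
      · exact (H194 n V hV hV' Ψ BΨ hΨB hΨ _ _ (Finset.Subset.refl _)).1 ⟨b, h.1⟩ ⟨c, h.2⟩
      · rw [abs_zero]; positivity
  have hTM : ∀ b c, ∑' b' : X d, T b b' * M b' c = if b = c then 1 else 0 := fun b c => by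
    simp only [hT]; exact (zd_coarse_mul_inverse hd a ha hlam hLam n V hV hV' Ψ BΨ hΨB hΨ M hM b c).2
  have hMT : ∀ b c, ∑' b' : X d, M b b' * T b' c = if b = c then 1 else 0 := fun b c => by
    simp only [hT]; exact (zd_coarse_inverse_mul hd a ha hlam hLam n V hV hV' Ψ BΨ hΨB hΨ M hM b c).2
  have hite : ∀ b c : X d, (if c = b then (1 : ℝ) else 0) = if b = c then 1 else 0 := by
    intro b c
    by_cases h : b = c
    · rw [if_pos h, if_pos h.symm]
    · rw [if_neg h, if_neg fun h' => h h'.symm]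
  -- (217) on `(T, M, E)`: the decaying RIGHT inverse
  obtain ⟨N, hNd, -, hNid⟩ := decaying_right_inverse (d := d) hCT.le hδT hc₁.le hη hν hνδ hνμ T M E hTd hMd hEd hTM hsmall3'
  have hright : ∀ b c, Summable (fun b' : X d => TK b b' * N b' c) ∧ ∑' b' : X d, TK b b' * N b' c = if b = c then 1 else 0 := by
    intro b c
    obtain ⟨-, -, hs, -, hid⟩ := hNid b c
    simp only [hTE] at hs hid
    exact ⟨hs, hid⟩
  -- (217) on the TRANSPOSED data: a decaying LEFT inverse
  have hTdt : ∀ b c, |T c b| ≤ CT * exp (-(δT * ∑ i, (((b i - c i).natAbs : ℕ) : ℝ))) := fun b c => by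
    rw [natAbs_sub_comm_sum]; exact hTd c b
  have hMdt : ∀ b c, |M c b| ≤ c₁ * exp (-(δ₁ * ∑ i, (((b i - c i).natAbs : ℕ) : ℝ))) := fun b c => by
    rw [natAbs_sub_comm_sum]; exact hMd c b
  have hEdt : ∀ b c, |E c b| ≤ 4 * CPK * θ * exp (-(μ * ∑ i, (((b i - c i).natAbs : ℕ) : ℝ))) := fun b c => by
    rw [natAbs_sub_comm_sum]; exact hEd c b
  have hTMt : ∀ b c, ∑' b' : X d, T b' b * M c b' = if b = c then 1 else 0 := fun b c => by
    rw [show (fun b' : X d => T b' b * M c b') = fun b' => M c b' * T b' b from funext fun _ => mul_comm _ _, hMT c b]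
    exact hite b c
  obtain ⟨N', hN'd, -, hN'id⟩ := decaying_right_inverse (d := d) hCT.le hδT hc₁.le hη hν hνδ hνμ
    (fun b c => T c b) (fun b c => M c b) (fun b c => E c b) hTdt hMdt hEdt hTMt hsmall3'
  have hleft' : ∀ b c, Summable (fun b' : X d => N' b' b * TK b' c) ∧ ∑' b' : X d, N' b' b * TK b' c = if b = c then 1 else 0 := by
    intro b c
    obtain ⟨-, -, hs, -, hid⟩ := hN'id c b
    simp only [hTE] at hs hid
    rw [hite] at hid
    have e : (fun b' : X d => TK b' c * N' b' b) = fun b' => N' b' b * TK b' c := funext fun _ => mul_comm _ _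
    rw [e] at hs hid
    exact ⟨hs, hid⟩
  -- (217): left inverse = right inverse
  have hLd : ∀ b c, |N' c b| ≤ 2 * (c₁ * exp (ν * d) * (2 * (1 - exp (-(δ₁ - ν)))⁻¹) ^ d)
      * exp (-(ν * ∑ i, (((b i - c i).natAbs : ℕ) : ℝ))) := fun b c => by
    rw [natAbs_sub_comm_sum]; exact hN'd c b
  have hKν : 0 < (2 * (1 - exp (-(δ₁ - ν)))⁻¹) ^ d := pow_pos (mul_pos two_pos (inv_pos.2 (sub_pos.2 (exp_lt_one_iff.2 (by linarith))))) d
  have hCN : 0 ≤ 2 * (c₁ * exp (ν * d) * (2 * (1 - exp (-(δ₁ - ν)))⁻¹) ^ d) := by positivity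
  have hLN : ∀ b c, N' c b = N b c := fun b c =>
    left_inverse_eq_right_inverse (d := d) hCN hν (by positivity) hCN hν TK (fun b c => N' c b) N hTKb
      hLd hNd (fun b c => (hright b c).2) (fun b c => (hleft' b c).2) b c
  refine ⟨N, hNd, fun b c => ?_, fun b c => ?_⟩
  · simp only [← hTK]; exact hright b c
  · have h := hleft' b c
    simp only [hLN] at h
    simp only [← hTK]; exact h

/-! ## §2. Toy -/

/-- Toy (`d = 3`, `a = 1`, `λ = 0`, `Λ = 1`): the five constants exist. -/
example : ∃ C₀ CP δ₀ c₁ δ₁ : ℝ, 0 < C₀ ∧ 0 < CP ∧ 0 < δ₀ ∧ 0 < c₁ ∧ 0 < δ₁ :=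
  let ⟨C₀, CP, δ₀, c₁, δ₁, h1, h2, h3, h4, h5, _⟩ := zd_perturbed_coarse_inverse (d := 3) le_rfl 1 one_pos (lam := 0) (Lam := 1)
    (by rw [min_eq_right (by norm_num : (1 : ℝ) ≤ 2)]; norm_num) zero_le_one
  ⟨C₀, CP, δ₀, c₁, δ₁, h1, h2, h3, h4, h5⟩

end Summit.QuantumFields.BalabanUV.T4Continuum.NE7b.SupZdPerturbedCoarseInverse
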